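import Literature.Probability.LatticeModels.WeaklyCoupledChain
import Literature.Probability.Distributions.GaussianPoincare
import Mathlib.MeasureTheory.Integral.IntervalIntegral.FundThmCalculus
import HarnessLib

/-!
# Weakly coupled chains: the one-step structure of the conditional expectations

`Literature/Probability/LatticeModels/` — second file of the `WeaklyCoupledChain*` series
(infrastructure in `WeaklyCoupledChain.lean`: box marginals, `Spec`, `weight/msg/condExp`).
For the explicit conditional expectations `E_k h = (∫_{tail k} h W_k)/R_k` of a nearest-neighbour
chain on `[0, L]^N` this file proves, all [folklore]:

* the one-step disintegration `E_k h (q) = (∫₀ᴸ w(t) E_{k+1}h(q[k↦t]) dt)/(∫₀ᴸ w(t) dt)` with the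
  positive weight `w(t) = φ_k R_{k+1}(q[k↦t])` (`condExp_eq_integral`, `msg_eq_integral`), hence
  averaging bounds (`condExp_le_of_forall_le`, `le_condExp_of_forall_le`,
  `condExp_le_condExp_of_forall_le`);
* the tower property `E_j E_k = E_j` (`condExp_condExp`) and the section identity
  `E_k h (q[i↦t]) = E_k (h(·[i↦t])) (q[i↦t])` for a conditioned coordinate `i < k`;
* the dependence on the last conditioned coordinate: `R_{k+1}(q[k↦s]) ≤ ρ₀² R_{k+1}(q[k↦t])`,
  `E_{k+1} g (q[k↦t]) ≤ ρ₀⁴ E_{k+1} g (q[k↦s])` for `g ≥ 0` not depending on `q_k`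
  (`ρ₀ = φ₊/φ₋`);
* single-coordinate averaging inside `E_k`: `E_k[∫₀ᴸ g(·[k↦r])dr] ≤ ρ₀² L E_k[g]`;
* the pointwise Poincaré step along one coordinate (FTC + Cauchy–Schwarz):
  `(f(p[i↦t]) - f(p[i↦s]))² ≤ L ∫₀ᴸ (∂_i f)(p[i↦r])² dr`.

These are the ingredients of the martingale-increment recursion proved in
`WeaklyCoupledChainStep.lean`. No definitions.
-/

noncomputable section

open MeasureTheory Function Set Filter
open scoped ENNReal Topology

namespace Literature.Probability.LatticeModels

namespace BoxChain

variable {N : ℕ}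

namespace Spec

variable (S : Spec N)

/-! ### One-step structure of the conditional expectations -/

section OneStep

variable {S}

/-- Updating the coordinate `k` and then the tail `tail (k+1)` is updating the tail at the
updated point (the coordinate `k` is not in `tail (k+1)`). [folklore] -/
theorem updateFinset_update_tail {k : ℕ} (hk : k < N) (q : Fin N → ℝ) (t : ℝ)
    (y : ↥(tail (N := N) (k + 1)) → ℝ) :
    updateFinset (update q ⟨k, hk⟩ t) (tail (k + 1)) y =
      update (updateFinset q (tail (k + 1)) y) ⟨k, hk⟩ t := by
  funext i
  by_cases hi : i ∈ tail (N := N) (k + 1)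
  · have hne : i ≠ ⟨k, hk⟩ := by
      rintro rfl; simp at hi
    simp [updateFinset, hi, update_of_ne hne]
  · by_cases hik : i = ⟨k, hk⟩
    · subst hik; simp [updateFinset, hi]
    · simp [updateFinset, hi, update_of_ne hik]

variable (S)

/-- **The tail marginal peels off the coordinate `k`**: for continuous `h` and `k < N`,
`∫_{tail k} h W_k (q) = ∫₀ᴸ φ_k R_{k+1} E_{k+1}h (q[k ↦ t]) dt`. [folklore] -/
theorem marginal_tail_mul_weight {k : ℕ} (hk : k < N) {h : (Fin N → ℝ) → ℝ} (hh : Continuous h)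
    (q : Fin N → ℝ) :
    marginal S.L (tail k) (fun p => h p * S.weight k p) q =
      ∫ t in Icc 0 S.L, S.φ ⟨k, hk⟩ (update q ⟨k, hk⟩ t) * S.msg (k + 1) (update q ⟨k, hk⟩ t) *
        S.condExp (k + 1) h (update q ⟨k, hk⟩ t) := by
  have hcont : Continuous fun p => h p * S.weight k p := hh.mul (S.continuous_weight k)
  rw [tail_eq_union hk, marginal_union hcont (disjoint_singleton_tail hk), marginal_singleton]
  refine setIntegral_congr_fun measurableSet_Icc fun t _ => ?_
  set q' := update q ⟨k, hk⟩ t with hq'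
  -- `∫_{tail (k+1)} h W_k = φ_k ∫_{tail (k+1)} h W_{k+1}` at `q'`
  have e1 : (fun p => h p * S.weight k p) =
      fun p => S.φ ⟨k, hk⟩ p * (h p * S.weight (k + 1) p) := by
    funext p; rw [S.weight_succ hk]; ring
  rw [e1, marginal_mul_left (S.dependsOn_φ_compl_tail hk)]
  simp only [condExp]
  rw [mul_assoc, ← mul_div_assoc, mul_div_cancel_left₀ _ (S.msg_pos (k + 1) q').ne']

/-- **The message recursion** `R_k(q) = ∫₀ᴸ φ_k R_{k+1} (q[k ↦ t]) dt` (`k < N`). [folklore] -/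
theorem msg_eq_integral {k : ℕ} (hk : k < N) (q : Fin N → ℝ) :
    S.msg k q = ∫ t in Icc 0 S.L, S.φ ⟨k, hk⟩ (update q ⟨k, hk⟩ t) * S.msg (k + 1) (update q ⟨k, hk⟩ t) := by
  have h := S.marginal_tail_mul_weight hk (h := fun _ => (1 : ℝ)) continuous_const q
  simp only [one_mul, condExp_one, mul_one] at h
  exact h

/-- **One-step disintegration**: `E_k h (q) = (∫₀ᴸ w(t) E_{k+1}h(q[k↦t]) dt) / (∫₀ᴸ w(t) dt)` with
the positive weight `w(t) = φ_k R_{k+1} (q[k ↦ t])` (`k < N`). [folklore] -/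
theorem condExp_eq_integral {k : ℕ} (hk : k < N) {h : (Fin N → ℝ) → ℝ} (hh : Continuous h)
    (q : Fin N → ℝ) :
    S.condExp k h q =
      (∫ t in Icc 0 S.L, S.φ ⟨k, hk⟩ (update q ⟨k, hk⟩ t) * S.msg (k + 1) (update q ⟨k, hk⟩ t) *
        S.condExp (k + 1) h (update q ⟨k, hk⟩ t)) / S.msg k q := by
  rw [condExp, S.marginal_tail_mul_weight hk hh]

/-- The one-step weight `t ↦ φ_k R_{k+1} (q[k ↦ t])` is continuous. [folklore] -/
theorem continuous_stepWeight {k : ℕ} (hk : k < N) (q : Fin N → ℝ) :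
    Continuous fun t : ℝ => S.φ ⟨k, hk⟩ (update q ⟨k, hk⟩ t) * S.msg (k + 1) (update q ⟨k, hk⟩ t) :=
  ((S.continuous_φ _).comp (continuous_const.update _ continuous_id)).mul
    ((S.continuous_msg _).comp (continuous_const.update _ continuous_id))

/-- The one-step weight is positive. [folklore] -/
theorem stepWeight_pos {k : ℕ} (hk : k < N) (q : Fin N → ℝ) (t : ℝ) :
    0 < S.φ ⟨k, hk⟩ (update q ⟨k, hk⟩ t) * S.msg (k + 1) (update q ⟨k, hk⟩ t) :=
  mul_pos (S.φlo_pos.trans_le (S.φlo_le _ _)) (S.msg_pos _ _)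

/-- **Averaging, upper bound**: if `E_{k+1} h (q[k ↦ t]) ≤ B` for all `t ∈ [0, L]` then
`E_k h (q) ≤ B` (`E_k h(q)` is a weighted average of these values). [folklore] -/
theorem condExp_le_of_forall_le {k : ℕ} (hk : k < N) {h : (Fin N → ℝ) → ℝ} (hh : Continuous h)
    (q : Fin N → ℝ) {B : ℝ} (hB : ∀ t ∈ Icc 0 S.L, S.condExp (k + 1) h (update q ⟨k, hk⟩ t) ≤ B) :
    S.condExp k h q ≤ B := by
  rw [S.condExp_eq_integral hk hh, div_le_iff₀ (S.msg_pos k q), S.msg_eq_integral hk]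
  rw [← integral_const_mul]
  have hw := S.continuous_stepWeight hk q
  have ha : Continuous fun t => S.condExp (k + 1) h (update q ⟨k, hk⟩ t) :=
    (S.continuous_condExp _ hh).comp (continuous_const.update _ continuous_id)
  refine setIntegral_mono_on (hw.mul ha).integrableOn_Icc (continuous_const.mul hw).integrableOn_Icc
    measurableSet_Icc fun t ht => ?_
  rw [mul_comm B]
  exact mul_le_mul_of_nonneg_left (hB t ht) (S.stepWeight_pos hk q t).le

/-- **Averaging, lower bound**: if `B ≤ E_{k+1} h (q[k ↦ t])` for all `t ∈ [0, L]` then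
`B ≤ E_k h (q)`. [folklore] -/
theorem le_condExp_of_forall_le {k : ℕ} (hk : k < N) {h : (Fin N → ℝ) → ℝ} (hh : Continuous h)
    (q : Fin N → ℝ) {B : ℝ} (hB : ∀ t ∈ Icc 0 S.L, B ≤ S.condExp (k + 1) h (update q ⟨k, hk⟩ t)) :
    B ≤ S.condExp k h q := by
  rw [S.condExp_eq_integral hk hh, le_div_iff₀ (S.msg_pos k q), S.msg_eq_integral hk]
  rw [← integral_const_mul]
  have hw := S.continuous_stepWeight hk q
  have ha : Continuous fun t => S.condExp (k + 1) h (update q ⟨k, hk⟩ t) :=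
    (S.continuous_condExp _ hh).comp (continuous_const.update _ continuous_id)
  refine setIntegral_mono_on (continuous_const.mul hw).integrableOn_Icc (hw.mul ha).integrableOn_Icc
    measurableSet_Icc fun t ht => ?_
  rw [mul_comm B]
  exact mul_le_mul_of_nonneg_left (hB t ht) (S.stepWeight_pos hk q t).le

/-- **Tower property, one step**: `E_k (E_{k+1} h) = E_k h`. [folklore] -/
theorem condExp_condExp_succ (k : ℕ) {h : (Fin N → ℝ) → ℝ} (hh : Continuous h) :
    S.condExp k (S.condExp (k + 1) h) = S.condExp k h := by
  by_cases hk : k < N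
  · funext q
    rw [S.condExp_eq_integral hk (S.continuous_condExp _ hh), S.condExp_eq_integral hk hh]
    congr 3
    rw [S.condExp_of_dependsOn (k + 1) (S.dependsOn_condExp (k + 1) h)]
  · rw [S.condExp_of_le (k := k + 1) (by omega)]

/-- **Tower property**: `E_j (E_k h) = E_j h` for `j ≤ k`. [folklore] -/
theorem condExp_condExp {j k : ℕ} (hjk : j ≤ k) {h : (Fin N → ℝ) → ℝ} (hh : Continuous h) :
    S.condExp j (S.condExp k h) = S.condExp j h := by
  induction k generalizing h with
  | zero =>
    obtain rfl : j = 0 := Nat.le_zero.mp hjk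
    exact S.condExp_of_dependsOn 0 (S.dependsOn_condExp 0 h)
  | succ k ih =>
    rcases Nat.lt_or_eq_of_le hjk with hlt | rfl
    · have hjk' : j ≤ k := Nat.lt_succ_iff.mp hlt
      calc S.condExp j (S.condExp (k + 1) h)
          = S.condExp j (S.condExp k (S.condExp (k + 1) h)) :=
            (ih hjk' (S.continuous_condExp _ hh)).symm
        _ = S.condExp j (S.condExp k h) := by rw [S.condExp_condExp_succ k hh]
        _ = S.condExp j h := ih hjk' hh
    · exact S.condExp_of_dependsOn _ (S.dependsOn_condExp _ h)

/-- The expectation of a conditional expectation: `E_0 (E_k h) = E_0 h`. [folklore] -/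
theorem condExp_zero_condExp (k : ℕ) {h : (Fin N → ℝ) → ℝ} (hh : Continuous h) :
    S.condExp 0 (S.condExp k h) = S.condExp 0 h :=
  S.condExp_condExp (Nat.zero_le k) hh

/-- `E_k h` at a point with a conditioned coordinate `i < k` set to `t` only sees the section
`h(·[i ↦ t])`. [folklore] -/
theorem condExp_update_eq_condExp_section {k : ℕ} {i : Fin N} (hi : i.val < k)
    (h : (Fin N → ℝ) → ℝ) (q : Fin N → ℝ) (t : ℝ) :
    S.condExp k h (update q i t) = S.condExp k (fun p => h (update p i t)) (update q i t) := by
  refine S.condExp_congr_fibre k _ _ _ fun y => ?_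
  have hit : i ∉ tail (N := N) k := by simp; omega
  congr 1
  funext l
  by_cases hl : l = i
  · subst hl
    simp [updateFinset, hit]
  · rw [update_of_ne hl]

end OneStep

/-! ### Dependence of `E_k h (q[k-1 ↦ t])` on the last conditioned coordinate -/

section Ratio

variable {S}

/-- On the tail fibre, changing the conditioned coordinate `k` does not change a function
that does not depend on the coordinate `k`. [folklore] -/
theorem apply_updateFinset_update_eq {k : ℕ} (hk : k < N) {g : (Fin N → ℝ) → ℝ}
    (hg : DependsOn g {j : Fin N | j ≠ ⟨k, hk⟩}) (q : Fin N → ℝ) (t s : ℝ)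
    (y : ↥(tail (N := N) (k + 1)) → ℝ) :
    g (updateFinset (update q ⟨k, hk⟩ t) (tail (k + 1)) y) =
      g (updateFinset (update q ⟨k, hk⟩ s) (tail (k + 1)) y) := by
  rw [updateFinset_update_tail hk, updateFinset_update_tail hk]
  exact hg fun j hj => by rw [update_of_ne hj, update_of_ne hj]

variable (S)

/-- Changing the conditioned coordinate `k` changes the message `R_{k+1}` by at most `ρ₀²`. [folklore] -/
theorem msg_succ_update_le {k : ℕ} (hk : k < N) (q : Fin N → ℝ) (s t : ℝ) :
    S.msg (k + 1) (update q ⟨k, hk⟩ s) ≤ S.ratio ^ 2 * S.msg (k + 1) (update q ⟨k, hk⟩ t) := by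
  simp only [msg]
  have e := congrFun (marginal_const_mul (L := S.L) (s := tail (k + 1)) (S.ratio ^ 2)
    (S.weight (k + 1))) (update q ⟨k, hk⟩ t)
  rw [← e]
  refine marginal_mono_fibre' (f := S.weight (k + 1)) (g := fun p => S.ratio ^ 2 * S.weight (k + 1) p)
    (S.continuous_weight _) (continuous_const.mul (S.continuous_weight _)) _ _ fun y => ?_
  show S.weight (k + 1) (updateFinset (update q ⟨k, hk⟩ s) (tail (k + 1)) y) ≤
    S.ratio ^ 2 * S.weight (k + 1) (updateFinset (update q ⟨k, hk⟩ t) (tail (k + 1)) y)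
  rw [updateFinset_update_tail hk, updateFinset_update_tail hk]
  have h1 := S.weight_le_sq_ratio_mul_weight_update (k + 1) ⟨k, hk⟩
    (update (updateFinset q (tail (k + 1)) y) ⟨k, hk⟩ s) t
  rwa [update_idem] at h1

/-- **Ratio bound**: for `g ≥ 0` not depending on the coordinate `k`,
`E_{k+1} g (q[k ↦ t]) ≤ ρ₀⁴ E_{k+1} g (q[k ↦ s])` — the conditional law of the tail given the
first `k+1` coordinates depends on `q_k` only through the factor `φ_{k+1}`, pinched in
`[φ₋, φ₊]` (the crude exponent `4` is immaterial). [folklore] -/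
theorem condExp_update_le_ratio_pow_mul {k : ℕ} (hk : k < N) {g : (Fin N → ℝ) → ℝ} (hg : Continuous g)
    (hg0 : ∀ p, 0 ≤ g p) (hgk : DependsOn g {j : Fin N | j ≠ ⟨k, hk⟩}) (q : Fin N → ℝ) (t s : ℝ) :
    S.condExp (k + 1) g (update q ⟨k, hk⟩ t) ≤
      S.ratio ^ 4 * S.condExp (k + 1) g (update q ⟨k, hk⟩ s) := by
  have hN : 0 < N := lt_of_le_of_lt (Nat.zero_le k) hk
  have hgw : Continuous fun p => g p * S.weight (k + 1) p := hg.mul (S.continuous_weight _)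
  -- numerators and denominators
  have hnum : marginal S.L (tail (k + 1)) (fun p => g p * S.weight (k + 1) p) (update q ⟨k, hk⟩ t) ≤
      S.ratio ^ 2 * marginal S.L (tail (k + 1)) (fun p => g p * S.weight (k + 1) p) (update q ⟨k, hk⟩ s) := by
    have e := congrFun (marginal_const_mul (L := S.L) (s := tail (k + 1)) (S.ratio ^ 2)
      (fun p => g p * S.weight (k + 1) p)) (update q ⟨k, hk⟩ s)
    rw [← e]
    refine marginal_mono_fibre' (f := fun p => g p * S.weight (k + 1) p)
      (g := fun p => S.ratio ^ 2 * (g p * S.weight (k + 1) p)) hgw (continuous_const.mul hgw)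
      _ _ fun y => ?_
    show g (updateFinset (update q ⟨k, hk⟩ t) (tail (k + 1)) y) *
        S.weight (k + 1) (updateFinset (update q ⟨k, hk⟩ t) (tail (k + 1)) y) ≤
      S.ratio ^ 2 * (g (updateFinset (update q ⟨k, hk⟩ s) (tail (k + 1)) y) *
        S.weight (k + 1) (updateFinset (update q ⟨k, hk⟩ s) (tail (k + 1)) y))
    rw [apply_updateFinset_update_eq hk hgk q t s y, mul_left_comm]
    refine mul_le_mul_of_nonneg_left ?_ (hg0 _)
    rw [updateFinset_update_tail hk, updateFinset_update_tail hk]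
    have h1 := S.weight_le_sq_ratio_mul_weight_update (k + 1) ⟨k, hk⟩
      (update (updateFinset q (tail (k + 1)) y) ⟨k, hk⟩ t) s
    rwa [update_idem] at h1
  have hden := S.msg_succ_update_le hk q s t
  have hRt := S.msg_pos (k + 1) (update q ⟨k, hk⟩ t)
  have hRs := S.msg_pos (k + 1) (update q ⟨k, hk⟩ s)
  have hnum0 : 0 ≤ marginal S.L (tail (k + 1)) (fun p => g p * S.weight (k + 1) p) (update q ⟨k, hk⟩ s) :=
    marginal_nonneg (fun p => mul_nonneg (hg0 p) (S.weight_pos _ p).le) _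
  -- abbreviations
  set Mt := marginal S.L (tail (k + 1)) (fun p => g p * S.weight (k + 1) p) (update q ⟨k, hk⟩ t) with hMt
  set Ms := marginal S.L (tail (k + 1)) (fun p => g p * S.weight (k + 1) p) (update q ⟨k, hk⟩ s) with hMs
  set Rt := S.msg (k + 1) (update q ⟨k, hk⟩ t) with hRt'
  set Rs := S.msg (k + 1) (update q ⟨k, hk⟩ s) with hRs'
  show Mt / Rt ≤ S.ratio ^ 4 * (Ms / Rs)
  rw [div_le_iff₀ hRt]
  have hMs_eq : Ms = Ms / Rs * Rs := (div_mul_cancel₀ _ hRs.ne').symm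
  calc Mt ≤ S.ratio ^ 2 * Ms := hnum
    _ = S.ratio ^ 2 * (Ms / Rs) * Rs := by rw [mul_assoc, ← hMs_eq]
    _ ≤ S.ratio ^ 2 * (Ms / Rs) * (S.ratio ^ 2 * Rt) :=
        mul_le_mul_of_nonneg_left hden (mul_nonneg (by positivity) (div_nonneg hnum0 hRs.le))
    _ = S.ratio ^ 4 * (Ms / Rs) * Rt := by ring

end Ratio

/-! ### Comparison of one-step averages -/

section Compare

/-- **Averaging, comparison form**: if `E_{k+1} H (q[k ↦ t]) ≤ E_{k+1} H' (q[k ↦ t])` for all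
`t ∈ [0, L]` then `E_k H (q) ≤ E_k H' (q)`. [folklore] -/
theorem condExp_le_condExp_of_forall_le {k : ℕ} (hk : k < N) {h h' : (Fin N → ℝ) → ℝ}
    (hh : Continuous h) (hh' : Continuous h') (q : Fin N → ℝ)
    (hle : ∀ t ∈ Icc 0 S.L, S.condExp (k + 1) h (update q ⟨k, hk⟩ t) ≤
      S.condExp (k + 1) h' (update q ⟨k, hk⟩ t)) :
    S.condExp k h q ≤ S.condExp k h' q := by
  rw [S.condExp_eq_integral hk hh, S.condExp_eq_integral hk hh']
  refine div_le_div_of_nonneg_right ?_ (S.msg_pos k q).le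
  have hw := S.continuous_stepWeight hk q
  have ha : Continuous fun t => S.condExp (k + 1) h (update q ⟨k, hk⟩ t) :=
    (S.continuous_condExp _ hh).comp (continuous_const.update _ continuous_id)
  have ha' : Continuous fun t => S.condExp (k + 1) h' (update q ⟨k, hk⟩ t) :=
    (S.continuous_condExp _ hh').comp (continuous_const.update _ continuous_id)
  exact setIntegral_mono_on (hw.mul ha).integrableOn_Icc (hw.mul ha').integrableOn_Icc
    measurableSet_Icc fun t ht => mul_le_mul_of_nonneg_left (hle t ht) (S.stepWeight_pos hk q t).le

end Compare

/-! ### Averaging over one coordinate inside `E_k` -/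

section SingleMarginal

/-- A single-coordinate box average of a nonnegative function against `W_k` is controlled by the
weighted average: `(∫₀ᴸ g(p[i↦r]) dr) W_k(p) ≤ ρ₀² ∫₀ᴸ (g W_k)(p[i↦r]) dr`. [folklore] -/
theorem marginal_singleton_mul_weight_le (k : ℕ) (i : Fin N) {g : (Fin N → ℝ) → ℝ} (hg : Continuous g)
    (hg0 : ∀ p, 0 ≤ g p) (p : Fin N → ℝ) :
    marginal S.L {i} g p * S.weight k p ≤
      S.ratio ^ 2 * marginal S.L {i} (fun p => g p * S.weight k p) p := by
  rw [marginal_singleton, marginal_singleton, ← integral_mul_const, ← integral_const_mul]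
  refine setIntegral_mono_on ?_ ?_ measurableSet_Icc fun r _ => ?_
  · exact ((hg.comp (continuous_const.update i continuous_id)).mul continuous_const).integrableOn_Icc
  · exact (continuous_const.mul ((hg.mul (S.continuous_weight k)).comp
      (continuous_const.update i continuous_id))).integrableOn_Icc
  · have h1 := S.weight_le_sq_ratio_mul_weight_update k i p r
    calc g (update p i r) * S.weight k p ≤ g (update p i r) * (S.ratio ^ 2 * S.weight k (update p i r)) :=
          mul_le_mul_of_nonneg_left h1 (hg0 _)
      _ = S.ratio ^ 2 * (g (update p i r) * S.weight k (update p i r)) := by ring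

/-- **Single-coordinate averaging inside `E_k`** (`k < N`, coordinate `k`): for `g ≥ 0`,
`E_k[∫₀ᴸ g(·[k↦r]) dr] ≤ ρ₀² L · E_k[g]`. [folklore] -/
theorem condExp_marginal_singleton_le {k : ℕ} (hk : k < N) {g : (Fin N → ℝ) → ℝ} (hg : Continuous g)
    (hg0 : ∀ p, 0 ≤ g p) (q : Fin N → ℝ) :
    S.condExp k (marginal S.L {(⟨k, hk⟩ : Fin N)} g) q ≤ S.ratio ^ 2 * S.L * S.condExp k g q := by
  have hMg : Continuous (marginal S.L {(⟨k, hk⟩ : Fin N)} g) := continuous_marginal hg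
  have hgW : Continuous fun p => g p * S.weight k p := hg.mul (S.continuous_weight k)
  -- numerator comparison
  have h1 : marginal S.L (tail k) (fun p => marginal S.L {(⟨k, hk⟩ : Fin N)} g p * S.weight k p) q ≤
      marginal S.L (tail k) (fun p => S.ratio ^ 2 *
        marginal S.L {(⟨k, hk⟩ : Fin N)} (fun p => g p * S.weight k p) p) q :=
    marginal_mono (hMg.mul (S.continuous_weight k)) (continuous_const.mul (continuous_marginal hgW))
      (fun p => S.marginal_singleton_mul_weight_le k ⟨k, hk⟩ hg hg0 p) q
  -- `∫_{tail k} ∫_{k} F = L ∫_{tail k} F`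
  have h2 : marginal S.L (tail k) (fun p => S.ratio ^ 2 *
        marginal S.L {(⟨k, hk⟩ : Fin N)} (fun p => g p * S.weight k p) p) q =
      S.ratio ^ 2 * S.L * marginal S.L (tail k) (fun p => g p * S.weight k p) q := by
    rw [marginal_const_mul]
    show S.ratio ^ 2 * marginal S.L (tail k) (marginal S.L {(⟨k, hk⟩ : Fin N)}
      (fun p => g p * S.weight k p)) q = _
    rw [mul_assoc]
    congr 1
    rw [tail_eq_union hk, marginal_union' (continuous_marginal hgW) (disjoint_singleton_tail hk),
      marginal_union' hgW (disjoint_singleton_tail hk),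
      marginal_of_dependsOn (s := {(⟨k, hk⟩ : Fin N)})
        (dependsOn_marginal S.L {(⟨k, hk⟩ : Fin N)} (fun p => g p * S.weight k p)) S.L_pos.le,
      Finset.card_singleton, pow_one, marginal_const_mul]
  simp only [condExp]
  rw [← mul_div_assoc, ← h2]
  exact div_le_div_of_nonneg_right h1 (S.msg_pos k q).le

end SingleMarginal

/-! ### The fundamental theorem of calculus along one coordinate -/

section FTC

variable {S}

/-- **Pointwise Poincaré step along one coordinate**: if `f` has the continuous partial
derivative `f'` along the coordinate `i`, then for `t, s ∈ [0, L]` and every `p`,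
`(f(p[i↦t]) - f(p[i↦s]))² ≤ L ∫₀ᴸ f'(p[i↦r])² dr`. [folklore] -/
theorem sq_sub_le_mul_marginal_sq {L : ℝ} {i : Fin N} {f f' : (Fin N → ℝ) → ℝ} (hf' : Continuous f')
    (hd : ∀ (p : Fin N → ℝ) (r : ℝ), HasDerivAt (fun r => f (update p i r)) (f' (update p i r)) r)
    {t s : ℝ} (ht : t ∈ Icc 0 L) (hs : s ∈ Icc 0 L) (p : Fin N → ℝ) :
    (f (update p i t) - f (update p i s)) ^ 2 ≤ L * marginal L {i} (fun p => f' p ^ 2) p := by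
  have hc : Continuous fun r => f' (update p i r) := hf'.comp (continuous_const.update i continuous_id)
  have hftc : ∀ a b : ℝ, f (update p i b) - f (update p i a) = ∫ r in a..b, f' (update p i r) := by
    intro a b
    rw [intervalIntegral.integral_eq_sub_of_hasDerivAt (fun r _ => hd p r) (hc.intervalIntegrable _ _)]
  have hM : marginal L {i} (fun p => f' p ^ 2) p = ∫ r in Icc 0 L, f' (update p i r) ^ 2 :=
    marginal_singleton L _ i p
  -- reduce to `a ≤ b`
  have key : ∀ a b : ℝ, a ∈ Icc 0 L → b ∈ Icc 0 L → a ≤ b →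
      (f (update p i b) - f (update p i a)) ^ 2 ≤ L * marginal L {i} (fun p => f' p ^ 2) p := by
    intro a b ha hb hab
    rw [hftc a b, hM]
    have hcs := Literature.Probability.Distributions.sq_intervalIntegral_le_mul hc hab
    have hsub : ∫ r in a..b, f' (update p i r) ^ 2 ≤ ∫ r in Icc 0 L, f' (update p i r) ^ 2 := by
      rw [intervalIntegral.integral_of_le hab]
      refine setIntegral_mono_set (hc.pow 2).integrableOn_Icc (ae_of_all _ fun r => sq_nonneg _)
        (ae_of_all _ ?_)
      exact (Ioc_subset_Icc_self.trans (Icc_subset_Icc ha.1 hb.2) : Ioc a b ⊆ Icc 0 L)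
    have hba : b - a ≤ L := by linarith [ha.1, hb.2]
    have hI0 : 0 ≤ ∫ r in a..b, f' (update p i r) ^ 2 :=
      intervalIntegral.integral_nonneg hab fun r _ => sq_nonneg _
    calc (∫ r in a..b, f' (update p i r)) ^ 2 ≤ (b - a) * ∫ r in a..b, f' (update p i r) ^ 2 := hcs
      _ ≤ L * ∫ r in Icc 0 L, f' (update p i r) ^ 2 :=
          mul_le_mul hba hsub hI0 (ha.1.trans ha.2)
  rcases le_total s t with hst | hts
  · exact key s t hs ht hst
  · rw [show (f (update p i t) - f (update p i s)) ^ 2 = (f (update p i s) - f (update p i t)) ^ 2 by ring]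
    exact key t s ht hs hts

end FTC

end Spec

end BoxChain

end Literature.Probability.LatticeModels

end
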